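import Literature.NumberTheory.EllipticCurves.BigRepModuleTotallySplitH1Proofs
import Literature.NumberTheory.EllipticCurves.BigGaloisRepSelmer
import Literature.NumberTheory.GaloisRepresentations.ConjugationDescent
import Literature.NumberTheory.GaloisRepresentations.DiscreteCochains
import HarnessLib

/-!
# The two `Λ`-linear MODELS at a finitely decomposed place: `M^N ≅ C^∞(ℤ_p, A^N)` and
# `H¹(N, M) ≅ C^∞(ℤ_p, H¹(N, A))`, under which a group element `ψ` (resp. its conjugation action) is the
# SHIFTED endomorphism `Φ ↦ F(Φ(· − κψ))` — no finiteness hypothesis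

Topic `NumberTheory/EllipticCurves`; namespace `Literature.NumberTheory.EllipticCurves.BigGaloisRep`.
THEOREMS ONLY (no definition, no named fact, no `sorry`). Cell `bsd-stepL`, K2 support 20495
`JSWSigmaLocalCharIdeal`, module L5 (steps (S2)/(S3) of `HOME/imc-p1/g13/L5-PLAN`, GENERAL case: the glue
between the cohomological frame `moduleFinite_isTorsion_mem_charIdeal_dual_h1_of_finite_ker_res` and the
`Λ`-algebra of the shifted endomorphism in Mahler coordinates, `BigRepModuleDualShiftedEndomorphism*` of the
typer lane); seat `bsd-stepL-imc-p1` g13.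

For `M = bigRep κ ρ` (co-induced model), `N ⊴ G` with `κ(N) = 1`, `ψ ∈ G`, `c = κψ`:
* **`exists_linearEquiv_invariantsOf_bigRep`** — a `Λ`-linear `e : C^∞(ℤ_p, A^N) ≃ M^N` (`mapRangeₗ` of
  `A^N ↪ A`) with `ψ · e(Φ) = e(τ_{−c}(F_* Φ))`, `F = ρ(ψ)|_{A^N}` (so `(ψ − 1)|_{M^N}` is the shifted
  endomorphism minus `1`, whose cokernel is `M^N/(ψ − 1)M^N ⊇` the unramified classes, Serre XIII §1);
* **`exists_linearEquiv_h1_subgroupRep_bigRep_conjMap`** — for `N` compact and `A` `p`-primary over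
  `ℤ_p`: a `Λ`-linear `e : H¹(N, M) ≃ C^∞(ℤ_p, H¹(N, A))` (the tree's totally split isomorphism for `N`,
  `BigRepModule.exists_linearEquiv_h1_bigRep_of_forall_eq_one`; the models `subgroupRep` ∕ `bigRep` of the
  restrictions agree definitionally) with `e(ψ·y) = τ_{−c}(F'_* (e y))`, `F' = conjMap ψ` on `H¹(N, A)` —
  so the `Λ`-submodule `H¹(N, M)^{ψ} ⊇ res(H¹(G, M))` is the kernel of the shifted endomorphism minus `1`.

References: [GreenbergVatsal2000] Prop. 2.4; [SkinnerUrban2014] §3.1.2–3.1.3, Prop. 3.2.3; [Castella2018] §2.1;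
[SerreLocalFields1979] VII §5, XIII §1.
-/

noncomputable section

open scoped Classical

open CategoryTheory Multiplicative

universe u v

namespace Literature.NumberTheory.EllipticCurves.BigGaloisRep

open Literature.NumberTheory.GaloisRepresentations BigRepModule

section Invariants

variable {𝒪 : Type u} [CommRing 𝒪] [TopologicalSpace 𝒪] {p : ℕ} [Fact p.Prime]
variable {G : Type v} [Group G] [TopologicalSpace G] [IsTopologicalGroup G]
variable {A : Type v} [AddCommGroup A] [Module 𝒪 A] [TopologicalSpace A] [DiscreteTopology A]
variable [TopologicalSpace (PowerSeries 𝒪)]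
variable (κ : G →ₜ* Multiplicative ℤ_[p]) (ρ : ContinuousRep G 𝒪 A) (N : Subgroup G) [N.Normal]

omit [N.Normal] in
/-- **`M^N ≅ C^∞(ℤ_p, A^N)`, `Λ`-linearly, with `ψ` acting as the shifted endomorphism.** For
`M = bigRep κ ρ` and `N ⊴ G` with `κ(N) = 1` there is a `Λ = 𝒪⟦T⟧`-linear isomorphism
`e : BigRepModule 𝒪 p (A^N) ≃ M^N` — `mapRangeₗ` of the inclusion `A^N ↪ A`, `(e Φ)(x) = Φ(x)` — such
that for every `ψ ∈ G`, `ψ · e(Φ) = e(τ_{−κψ}((ρψ)_* Φ))`: on `M^N` the element `ψ` IS the shifted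
endomorphism `Φ ↦ ρ(ψ)(Φ(· − κψ))`. [cite: SkinnerUrban2014, §3.1.3 (the co-induced model)]
[cite: GreenbergVatsal2000, Prop. 2.4] -/
theorem exists_linearEquiv_invariantsOf_bigRep (hκN : ∀ n ∈ N, κ n = 1) :
    ∃ e : BigRepModule 𝒪 p (ρ.invariantsOf N) ≃ₗ[PowerSeries 𝒪] (bigRep κ ρ).invariantsOf N,
      (∀ (Φ : BigRepModule 𝒪 p (ρ.invariantsOf N)) (x : ℤ_[p]),
        ((e Φ : BigRepModule 𝒪 p A) x) = ((Φ x : ρ.invariantsOf N) : A)) ∧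
      ∀ (ψ : G) (hψ : ∀ a ∈ ρ.invariantsOf N, ρ ψ a ∈ ρ.invariantsOf N)
        (Φ : BigRepModule 𝒪 p (ρ.invariantsOf N)),
        bigRep κ ρ ψ (e Φ : BigRepModule 𝒪 p A) =
          (e (BigRepModule.translate (-(κ ψ).toAdd) (mapRange ((ρ ψ).restrict hψ) Φ)) :
            BigRepModule 𝒪 p A) := by
  -- `Φ ∈ M^N` iff `Φ` is `A^N`-valued
  have hmem : ∀ Φ : BigRepModule 𝒪 p A,
      Φ ∈ (bigRep κ ρ).invariantsOf N ↔ ∀ x, Φ x ∈ ρ.invariantsOf N := by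
    intro Φ
    rw [ContinuousRep.mem_invariantsOf_iff]
    simp_rw [ContinuousRep.mem_invariantsOf_iff]
    constructor
    · intro hΦ x n
      have h := congrArg (fun Ψ : BigRepModule 𝒪 p A => Ψ x) (hΦ n)
      have hn : (κ (n : G)).toAdd = 0 := by rw [hκN n n.2]; rfl
      simp only [bigRep_apply_apply, hn, sub_zero] at h
      exact h
    · intro hΦ n
      ext x
      have hn : (κ (n : G)).toAdd = 0 := by rw [hκN n n.2]; rfl
      rw [bigRep_apply_apply, hn, sub_zero]
      exact hΦ x n
  -- the corestriction of `mapRangeₗ (A^N).subtype` to `M^N`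
  set i : BigRepModule 𝒪 p (ρ.invariantsOf N) →ₗ[PowerSeries 𝒪] BigRepModule 𝒪 p A :=
    mapRangeₗ (ρ.invariantsOf N).subtype with hi
  have hirange : ∀ Φ, i Φ ∈ (bigRep κ ρ).invariantsOf N := fun Φ =>
    (hmem _).mpr fun x => (Φ x).2
  have hinj : Function.Injective (i.codRestrict _ hirange) := by
    intro Φ Ψ h
    have h' : i Φ = i Ψ := congrArg Subtype.val h
    exact mapRange_injective Subtype.val_injective h'
  have hsurj : Function.Surjective (i.codRestrict _ hirange) := by
    intro v
    have hv : ∀ x, (v : BigRepModule 𝒪 p A) x ∈ ρ.invariantsOf N := (hmem _).mp v.2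
    obtain ⟨n, hn⟩ := (v : BigRepModule 𝒪 p A).exists_level
    obtain ⟨k, hk⟩ := (v : BigRepModule 𝒪 p A).exists_torsion
    refine ⟨BigRepModule.mk (fun x => ⟨(v : BigRepModule 𝒪 p A) x, hv x⟩)
      ⟨⟨n, fun x y hxy => Subtype.ext (hn x y hxy)⟩, ⟨k, fun x => Subtype.ext (by simpa using hk x)⟩⟩,
      Subtype.ext (BigRepModule.ext fun x => rfl)⟩
  refine ⟨LinearEquiv.ofBijective (i.codRestrict _ hirange) ⟨hinj, hsurj⟩, fun Φ x => rfl, ?_⟩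
  intro ψ hψ Φ
  apply BigRepModule.ext
  intro x
  change ρ ψ ((mapRange (ρ.invariantsOf N).subtype Φ) (x - (κ ψ).toAdd)) =
    (mapRange (ρ.invariantsOf N).subtype
      (BigRepModule.translate (-(κ ψ).toAdd) (mapRange ((ρ ψ).restrict hψ) Φ))) x
  rw [mapRange_apply, mapRange_apply, BigRepModule.translate_apply, mapRange_apply, ← sub_eq_add_neg]
  rfl

end Invariants

section Cohomology

variable {p : ℕ} [hp : Fact p.Prime] {A : Type u} [AddCommGroup A] [Module ℤ_[p] A]
  [TopologicalSpace A] [DiscreteTopology A] [ContinuousSMul ℤ_[p] A]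
  {G : Type u} [Group G] [TopologicalSpace G] [IsTopologicalGroup G]
  [TopologicalSpace (PowerSeries ℤ_[p])] [ContinuousSMul (PowerSeries ℤ_[p]) (BigRepModule ℤ_[p] p A)]
  (κ : G →ₜ* Multiplicative ℤ_[p]) (ρ : ContinuousRep G ℤ_[p] A) (N : Subgroup G) [N.Normal]
  [CompactSpace N]

/-- **`H¹(N, M) ≅ C^∞(ℤ_p, H¹(N, A))`, `Λ`-linearly, with the conjugation by `ψ` acting as the shifted
endomorphism.** For `M = bigRep κ ρ`, `N ⊴ G` compact with `κ(N) = 1`, `A` discrete `p`-primary over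
`ℤ_p`, there is a `Λ`-linear isomorphism `e : H¹(N, M) ≃ BigRepModule ℤ_[p] p (H¹(N, A))` (evaluation of
cocycles: `(e[c])(x) = [d ↦ c(d)(x)]`) with `e(ψ · y) = τ_{−κψ}((ψ·)_* (e y))` for every `ψ ∈ G`, where
`ψ·` is the tree's conjugation action `conjMap` on `H¹(N, M)` resp. `H¹(N, A)`.
[cite: SkinnerUrban2014, §3.1.2 and Prop. 3.2.3] [cite: GreenbergVatsal2000, Prop. 2.4] [cite: SerreLocalFields1979, VII §5] -/
theorem exists_linearEquiv_h1_subgroupRep_bigRep_conjMap (hκN : ∀ n ∈ N, κ n = 1)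
    (hA : ∀ a : A, ∃ k : ℕ, p ^ k • a = 0) :
    ∃ e : continuousCohomology 1 (subgroupRep (bigRep κ ρ).toTopRep N) ≃ₗ[PowerSeries ℤ_[p]]
        BigRepModule ℤ_[p] p (continuousCohomology 1 (subgroupRep ρ.toTopRep N)),
      (∀ (cz : contOneCocycles (subgroupRep (bigRep κ ρ).toTopRep N)) (x : ℤ_[p])
          (z : contOneCocycles (subgroupRep ρ.toTopRep N)),
          (∀ d : N, z.1 d = (cz.1 d : BigRepModule ℤ_[p] p A) x) →
            e (oneCocycleClass _ cz) x = oneCocycleClass (subgroupRep ρ.toTopRep N) z) ∧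
      ∀ (ψ : G) (y : continuousCohomology 1 (subgroupRep (bigRep κ ρ).toTopRep N)),
        e (conjMap (bigRep κ ρ).toTopRep N ψ 1 y) =
          BigRepModule.translate (-(κ ψ).toAdd)
            (mapRange (conjMap ρ.toTopRep N ψ 1).hom.toLinearMap (e y)) := by
  set κN : N →ₜ* Multiplicative ℤ_[p] := κ.comp (subgroupSubtypeHom N) with hκNdef
  set ρN : ContinuousRep N ℤ_[p] A := ρ.restrict (subgroupSubtypeHom N) with hρNdef
  have hκN' : ∀ d : N, κN d = 1 := fun d => hκN d d.2
  obtain ⟨e, he⟩ := exists_linearEquiv_h1_bigRep_of_forall_eq_one κN ρN hκN' hA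
  set X := (bigRep κ ρ).toTopRep with hXdef
  -- the models agree definitionally: `(bigRep κN ρN).toTopRep = subgroupRep X N`, `ρN.toTopRep = subgroupRep ρ.toTopRep N`
  let e' : continuousCohomology 1 (subgroupRep X N) ≃ₗ[PowerSeries ℤ_[p]]
      BigRepModule ℤ_[p] p (continuousCohomology 1 (subgroupRep ρ.toTopRep N)) := e
  have he' : ∀ (cz : contOneCocycles (subgroupRep X N)) (x : ℤ_[p])
      (z : contOneCocycles (subgroupRep ρ.toTopRep N)),
      (∀ d : N, z.1 d = (cz.1 d : BigRepModule ℤ_[p] p A) x) →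
        e' (oneCocycleClass _ cz) x = oneCocycleClass (subgroupRep ρ.toTopRep N) z :=
    fun cz x z hz => he cz x z hz
  refine ⟨e', he', fun ψ y => ?_⟩
  set c : ℤ_[p] := (κ ψ).toAdd with hc
  obtain ⟨cz, rfl⟩ := oneCocycleClass_surjective (subgroupRep X N) y
  apply BigRepModule.ext
  intro x
  obtain ⟨z₀, hz₀⟩ := exists_contOneCocycles_eval κN ρN hκN' cz (x - c)
  set z' : contOneCocycles (subgroupRep ρ.toTopRep N) :=
    contOneCocycles.pullback (subgroupConj N ψ) (conjRepHom ρ.toTopRep N ψ) z₀ with hz'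
  have hz'eval : ∀ d : N, z'.1 d =
      ((contOneCocycles.pullback (subgroupConj N ψ) (conjRepHom X N ψ) cz).1 d :
        BigRepModule ℤ_[p] p A) x := by
    intro d
    rw [hz', conj_pullback_apply, conj_pullback_apply, hz₀]
    rfl
  rw [conjMap_oneCocycleClass, he' _ x z' hz'eval]
  rw [BigRepModule.translate_apply, mapRange_apply, ← sub_eq_add_neg, he' cz (x - c) z₀ hz₀]
  change _ = (conjMap ρ.toTopRep N ψ 1) (oneCocycleClass (subgroupRep ρ.toTopRep N) z₀)
  rw [conjMap_oneCocycleClass]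

end Cohomology

end Literature.NumberTheory.EllipticCurves.BigGaloisRep

end
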